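import Mathlib
import Summits.Langlands.Langlands.Theses.PhantomRMYoshida
import Literature.RingTheory.CompleteIntersection.NumericalCriterion
import Literature.NumberTheory.GaloisRepresentations.DeformationFiniteLevel
import Literature.NumberTheory.GaloisRepresentations.StableLatticeValuationRing

/-!
# Line `endoscopic-crossing-euler` — skeleton for crux `PhantomRMYoshida.ResiduallyYoshidaLifting`
# (stmt-Langlands-13639, route-Langlands-PhantomRMYoshida; crux-plan, round 1)

**Idea** (crux-idea card `endoscopic-crossing-euler`, ideator 1; triage r1: pass ×3, merge ≈
`padic-l-function-as-steinberg-place` ≈ `yoshida-divisor-selmer-count` (b)).  In the Λ-adic ordinary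
deformation / Hida picture at the residually Yoshida point `ρ̄ = σ̄ ⊕ σ̄'`, the reducible (Yoshida) locus
`Y ≅ Spf 𝕀_F ⊗̂ 𝕀_G` is full-dimensional and entirely modular, so it cannot be made small (the Thorne /
Allen–Newton–Thorne Steinberg place is unavailable: `N² = 0`).  Instead it is used as the AUGMENTATION of a
Wiles–Lenstra numerical criterion run at a HEIGHT-ONE prime `P` of `Y` through which the irreducible
component `S_ρ ∋ x_ρ` of the deformation space passes ("endoscopic–stable crossing prime"): over the
complete discrete valuation ring `O' = (𝕀_{F,G})_P^∧` (residue field of characteristic `0` or `p`, NOT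
finite) one has `length Φ_{R,P} ≤ length Ψ_{𝕋,P}`, the left side bounded by the Beilinson–Flach Euler
system through the Rankin–Selberg Greenberg Selmer module of `Hom(ρ_G, ρ_F)` (GMA / Bellaïche–Chenevier:
`I_P/I_P² ↠ B ⊗ C`, `B ≅ C`), the right side bounded below by the divisibility `θ_{F,G} ∣ 𝒞_{Yos}`
of Hida's `p`-adic Rankin–Selberg `L`-function in the Yoshida congruence ideal (Hsieh–Liu, announced in
Hsieh–Palvannan arXiv:2505.09975 §1.5 — NOT in print: the bet of the line); the criterion gives
`R_P ≅ 𝕋_P`, hence `x_ρ ∈ Spec 𝕋` ("Skinner–Wiles propagation": `ker φ ⊆ ker(R → R_P) ⊆ ker x_ρ`), hence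
`tr ρ` is a `p`-adic limit of traces of ordinary Siegel–Hida eigensystems of tame level `S`, and weight-(2,2)
classicality + `GSp₄ → GL₄` transfer finish.

**Shape.** `ResiduallyYoshidaLifting_of : ResiduallyYoshidaLifting` (no hypotheses) is proved at the end
of this file from four `stub_*` theorems; `sorry` occurs only inside the stubs; stub statements mention
only Mathlib, `Literature.*` and (verbatim) the clauses of the route decl, so each can land as
`Theorems/ResiduallyYoshidaLifting<Stub>.lean` with `--supports stmt-Langlands-13639`.

* `stub_numericalCriterion` — de Smit–Rubin–Schoof Criterion I in the direction used (complete DVR with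
  ARBITRARY residue field).  Pure commutative algebra; provable now (L).  Tree: the forward half of the
  named fact `Literature.RingTheory.CompleteIntersection.numericalCriterion_eq_iff` (unproved); the
  inequality half `numericalCriterion_le_holds` is proved.
* `stub_residualYoshidaSplitting` — a symplectic `ρ : Γ_ℚ → GL₄(ℚ̄_p)` whose Frobenius polynomials reduce
  to `charpoly σ̄ · charpoly σ̄'` (`σ̄ ≇ σ̄'` irreducible, `det = ε̄⁻¹ =` residual multiplier) has a
  `ℤ̄_p`-frame with SPLIT reduction `σ̄ ⊕ σ̄'` (self-dual lattice exists because the value group of `ℤ̄_p`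
  is divisible; card `padic-l-function-as-steinberg-place` first lemma `symplectic_invariant_complement`
  does the rest).  Provable now (M/L).  Entry ticket to the deformation theory of the split `ρ̄` (Schur).
* `stub_yoshidaCrossingRT` — THE LEVER (hardest, the line's bet): the Λ-adic package at the Yoshida
  maximal ideal (`R ↠ 𝕋`, the trace `𝒯` of the universal deformation, the point `x_ρ`), its localisation
  and completion at an endoscopic–stable crossing prime `P` in the exact shape of Criterion I
  (`O'`, `R' = R_P^∧`, `T' = 𝕋_P^∧`, `φ'`, Yoshida augmentation `π'`), the CROSSING `ker(R → R') ≤ ker x_ρ`,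
  the Rankin–Selberg main-conjecture inequality `length Φ ≤ length Ψ` (Beilinson–Flach ES + Hsieh–Liu
  `θ ∣ 𝒞`), and density + control on `𝕋` (every point of `𝕋` over the weight of `x_ρ` is a `p`-adic limit of
  points whose traces are automorphic (cuspidal on `GL₄`) or endoscopic (sum of two 2-dimensional traces),
  Greenberg-ordinary of regular weight, of tame level `S`, `GSp`-valued).  The two analytic inequalities
  cannot be separate stubs without a typed `θ_{F,G}` (no `p`-adic Rankin–Selberg `L`-function in the tree):
  they are the two halves of the single conjunct `length Φ ≤ length Ψ` (line card, Stubs §3).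
* `stub_weightTwoClassicality` — the shared debt of every line of this crux (triage r1-2 "Shared debts",
  r1-3 Summary): an irreducible, symplectic-`ε⁻¹`, Greenberg-ordinary `(0,0,1,1)`, `p`-distinguished `ρ`
  whose trace is a `p`-adic limit of automorphic-or-endoscopic ordinary regular-weight traces of bounded
  tame level is automorphic (BCGP / Pilloni higher Hida theory in weight `(2,2)` at an endoscopic `𝔪`,
  Arthur / Gee–Taïbi transfer).  Open.

**Glue** (sorry-free, below): criterion ⇒ `φ'` bijective ⇒ `ker φ ≤ ker ιR ≤ ker x_ρ` (commuting square +
crossing) ⇒ `x_ρ = y ∘ φ` (`RingHom.liftOfSurjective`) ⇒ density/control at `y` gives the approximants ⇒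
classicality ⇒ `Aut ρ`.  `ρ.IsIrreducible` is consumed exactly at the last step (a reducible `ρ_f ⊕ ρ_g`
passes every earlier step and is correctly NOT automorphic on `GL₄`), `Aut ρ₀` / `Sh ρ₀` only inside the
package (non-emptiness of the stable ordinary Hecke algebra at `𝔪` at the common tame level; ANT Prop. 5.3
style propagation is not needed in the height-one form).

**Disproof used** (cdisprove gen 2, `Disproof.lean` 2026-08-15T23:13Z; body not mounted in this jail —
read through its evidence notes, like all three triagers): `iff_withoutOdd` — no stub takes `σ.IsOdd` /
`σ'.IsOdd`; `not_withoutIrreducibleρ_of_witness` (refuted strengthening `WithoutIrreducibleρ`, witness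
`ρ_f ⊕ ρ_f'` + Jacquet–Shalika) — honoured: `ρ.toGaloisRep.IsIrreducible` is a hypothesis of
`stub_weightTwoClassicality`, and the endoscopic alternative `Endo` in the pro-automorphy clause is exactly
the witness's shape; `iff_absoluteOnFibres` / `iff_congruenceLifting` — the package stub is stated on the
fibre (same `red`, `σ`, `σ'`) and uses `ρ₀` only as the automorphic point of the fibre; `red_factors`,
`map_red_eq_iff` ((k, red) idle) — the split frame of `stub_residualYoshidaSplitting` is taken up to a
residual conjugation `h ∈ GL₄(k)` precisely because `σ`, `σ'` need not have entries in `red(ℤ̄_p) = 𝔽̄_p`;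
`trace_complexConjugation_eq_zero`, `cycMul_of_isComplexConjugation` — not used (no auxiliary primes in
this line).  No `_false_without_` theorem beyond these is recorded; no `Negative/` lemma has landed for
this crux (nothing to import); no stub is an instance of a refuted statement (negatives index: 1 entry,
K3 Kuga–Satake, unrelated).
-/

open Literature.NumberTheory.GaloisRepresentations
open Literature.RingTheory.CompleteIntersection

namespace Summit.Langlands.Langlands.Cruxes.ResiduallyYoshidaLifting.EndoscopicCrossingEuler

set_option linter.dupNamespace false
set_option linter.overlappingInstances false

/-! ## Stub 1 — the Wiles–Lenstra numerical criterion over a complete DVR with arbitrary residue field -/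

/-- **Stub 1 (numerical criterion, direction used).**  `O` a complete discrete valuation ring (NO
hypothesis on its residue field: in the line `O = (𝕀_{F,G})_P^∧` has residue field `Frac(𝕀_{F,G}/P)`, of
characteristic `0` or `p` and infinite), `R` a complete Noetherian local `O`-algebra, `T` a local
`O`-algebra finite free over `O`, `φ : R ↠ T`, `π : T → O` an augmentation with congruence ideal
`η_T ≠ 0`; if `length_O (I_R/I_R²) ≤ length_O (O/η_T)` then `φ` is an isomorphism (of complete
intersections).  Why true: de Smit–Rubin–Schoof 1997, Criterion I (Lenstra): Fitting ideals,
`Fit_O(I_R/I_R²) ⊆ η_T` (tree: `fittingIdeal_cotangentModule_le_congruenceIdeal`, proved) and Tate's theorem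
on complete intersections (their Cor. 2.3); the printed proof never uses finiteness of the residue field
(triage r1-2/r1-3 falsifier (i): passes).  In the tree this is the forward half of the named fact
`numericalCriterion_eq_iff` (unproved) at universes `0,0,0`; `numericalCriterion_le_holds` is the proved
converse inequality.  Size L (~600 lines: complete intersections over `O`, Tate/Wiebe).
[cite: DeSmitRubinSchoof1997, Criterion I p. 344 and §3; DarmonDiamondTaylor1995, Thm. 5.3] -/
theorem stub_numericalCriterion :
    ∀ (O : Type) [CommRing O] [IsDomain O] [IsDiscreteValuationRing O]
      [IsAdicComplete (IsLocalRing.maximalIdeal O) O]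
      (R : Type) [CommRing R] [IsLocalRing R] [IsNoetherianRing R]
      [IsAdicComplete (IsLocalRing.maximalIdeal R) R] [Algebra O R]
      (T : Type) [CommRing T] [IsLocalRing T] [Algebra O T] [Module.Finite O T] [Module.Free O T]
      (φ : R →ₐ[O] T) (π : T →ₐ[O] O),
      Function.Surjective φ → congruenceIdeal π ≠ ⊥ →
        Module.length O (CotangentModule (π.comp φ)) ≤ Module.length O (CongruenceModule π) →
          Function.Bijective φ := by
  sorry

/-! ## Stub 2 — a symplectic lattice with split residual Yoshida reduction

RESHAPED by the lead (2026-08-16, second lead prover-line-stmt-Langlands-13639-b-0): the registered statement of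
the planner's `stub_residualYoshidaSplitting` is kept VERBATIM but is now PROVED in this file
(`residualYoshidaSplitting_of_stubs`) from four smaller registered stubs, each provable now with tree support and
none needing the self-dual-lattice theory of the card:

* `stub_residualCharpoly` (2a, Chebotarev step) — for an integral model `rint` of `r` over `ℤ̄_p = 𝒪_{ℚ̄_p}`, the
  a.e. Frobenius clause upgrades to the identity `red(det(X - rint g)) = det(X - σ g) · det(X - σ' g)` for EVERY
  `g ∈ Γ_ℚ` (Frobenius density from the DISCHARGED `chebotarev_artinRep_holds` via
  `absoluteGaloisGroup.frobenius_dense`; both sides are locally constant in `g` because `red` kills `𝔪_{ℤ̄_p}`).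
* `stub_residualTriangular` (2b, residual algebra) — over an algebraically closed `k₀ → k`: a `ρ̄ : Γ → GL₄(k₀)` whose
  characteristic polynomials map to `charpoly σ · charpoly σ'` (`σ, σ'` irreducible of rank 2 over `k`) is conjugate
  OVER `k₀` to a block upper triangular form with diagonal blocks `a, d : Γ → GL₂(k₀)` that stay irreducible over `k`
  (Brauer–Nesbitt `Representation.nonempty_equiv_of_charpoly_eq` + semisimplification + Burnside descent
  `span_eq_top_of_isIrreducible` / `span_range_map_eq_top_iff`; the excluded shapes are a stable line / hyperplane,
  which would put a character inside `σ ⊕ σ'`).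
* `stub_blockSumConj` (2c, Brauer–Nesbitt assembly) — two block sums of rank-2 irreducibles with the same
  characteristic polynomials are conjugate in `GL₄(k)`.
* `stub_splitFrame` (2d, the ϖ-trick replacing self-dual lattices) — an integral model whose reduction is block upper
  triangular after a residual change of basis `w` is conjugate (in `GL₄(ℚ̄_p)`, by a lift of `w` and
  `diag(1,1,ϖ,ϖ)` with `|c(g)| ≤ |ϖ|² < 1` uniformly on the compact `Γ_ℚ`; `ℚ̄_p` contains `p^{1/N}`) to an integral
  model with block DIAGONAL reduction and the same diagonal blocks.

The composition below supplies: `red` factors through the residue field `κ = ℤ̄_p/𝔪` (`red` kills `𝔪` since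
`char k = p`), `κ` is algebraically closed, and the integral model over the (non-noetherian) valuation ring `ℤ̄_p`
(`exists_integralModel_of_valuationSubring`).  Hypotheses of the registered statement that turn out to be unused
(`p ≠ 2`, `IsAlgClosed k`, irreducibility of `r`, non-conjugacy of `σ, σ'`, the symplectic pairing) are kept, since
the statement is registered verbatim. -/

/-- **Stub 2a (residual characteristic polynomials of an integral model; Chebotarev).**  Let
`r : Γ_ℚ → GL₄(ℚ̄_p)` be continuous, `rint : Γ_ℚ → GL₄(ℤ̄_p)` a homomorphism with `rint = P⁻¹ r P`, and suppose the
crux's residual clause: at almost all `v`, `r, σ, σ'` are unramified and the integral Frobenius polynomial of `r`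
reduces through `red : ℤ̄_p → k` to `charpoly σ(Frob_v) · charpoly σ'(Frob_v)`.  Then for EVERY `g ∈ Γ_ℚ`,
`red (det(X - rint g)) = det(X - σ g) · det(X - σ' g)`.  Why true: `red` kills the maximal ideal of `ℤ̄_p`
(`char k = p`), so `g ↦ red(rint g)` is locally constant, as are `σ, σ'` (discrete `k`); the identity holds at every
arithmetic Frobenius outside a finite set (uniqueness of Frobenius polynomials, `HasFrobCharpolyAt.unique(_map)`,
`IsUnramifiedAt.hasFrobCharpolyAt_charpoly`, conjugation invariance of `charpoly`), and these are dense
(`absoluteGaloisGroup.frobenius_dense chebotarev_artinRep_holds`).  Size M (~200 lines).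
[cite: SerreAbelianLadic1968, Ch. I §2.2 Cor. 2 (a) and §2.3; DeligneSerre1974, §6] -/
theorem stub_residualCharpoly :
    ∀ (p : ℕ) [Fact p.Prime] (k : Type) [Field k] [CharP k p] [TopologicalSpace k] [DiscreteTopology k]
      (red : Valued.integer (PadicAlgCl p) →+* k)
      (σ σ' : Literature.NumberTheory.GaloisRepresentations.FramedGaloisRep ℚ k 2)
      (r : Literature.NumberTheory.GaloisRepresentations.FramedGaloisRep ℚ (PadicAlgCl p) 4)
      (P : GL (Fin 4) (PadicAlgCl p))
      (rint : Field.absoluteGaloisGroup ℚ →* GL (Fin 4) (Valued.integer (PadicAlgCl p))),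
      (∀ g, Matrix.GeneralLinearGroup.map (Valued.integer (PadicAlgCl p)).subtype (rint g) = P⁻¹ * r g * P) →
      (∀ᶠ v : IsDedekindDomain.HeightOneSpectrum (NumberField.RingOfIntegers ℚ) in Filter.cofinite,
        r.IsUnramifiedAt v ∧ σ.IsUnramifiedAt v ∧ σ'.IsUnramifiedAt v ∧
        ∃ (P : Polynomial (Valued.integer (PadicAlgCl p))) (P₁ P₂ : Polynomial k),
          r.HasFrobCharpolyAt v (P.map (Valued.integer (PadicAlgCl p)).subtype) ∧
          σ.HasFrobCharpolyAt v P₁ ∧ σ'.HasFrobCharpolyAt v P₂ ∧ P.map red = P₁ * P₂) →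
      ∀ g, ((rint g).val.charpoly).map red = (σ g).val.charpoly * (σ' g).val.charpoly := by
  sorry

/-- **Stub 2b (residual algebra: block-triangular form over an algebraically closed subfield, irreducible
diagonal blocks).**  `k₀` algebraically closed, `f : k₀ → k` a field map, `ρ : Γ → GL₄(k₀)`, `σ, σ' : Γ → GL₂(k)`
irreducible on `k²`, and `f(det(X - ρ g)) = det(X - σ g) det(X - σ' g)` for all `g`.  Then there are
`w ∈ GL₄(k₀)`, homomorphisms `a, d : Γ → GL₂(k₀)` and `b : Γ → M₂(k₀)` with `w⁻¹ ρ(g) w = (a g, b g; 0, d g)` (blocks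
along `finSumFinEquiv : Fin 2 ⊕ Fin 2 ≃ Fin 4`), and `a, d` irreducible over `k`.  Why true: the representation
`τ = σ ⊕ σ'` on `k⁴` is semisimple and contains no `Γ`-stable line (a stable line projects to zero in the irreducible
planes `σ, σ'`); if `ρ ⊗ k` were irreducible it would be semisimple with the characteristic polynomials of `τ`, hence
equivalent to `τ` (Brauer–Nesbitt, `Representation.nonempty_equiv_of_charpoly_eq`) and reducible — so `ρ ⊗ k` is
reducible, hence (Burnside over the algebraically closed `k₀`: `span_eq_top_of_isIrreducible`,
`span_range_map_eq_top_iff`, `isIrreducible_of_span_eq_top`) `ρ` is reducible over `k₀`; dévissage along a proper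
stable `k₀`-subspace `W₀` (adapted basis, as in `exists_blocks_of_subrepresentation`) gives blocks of ranks
`(m, 4 - m)`; `m = 1` or `3` (and likewise a reducible diagonal block) would, after semisimplifying
(`exists_semisimplification`) and Brauer–Nesbitt, put a `Γ`-stable LINE inside `τ` — excluded.  Size M/L
(~350 lines).  Non-conjugacy of `σ, σ'` is not needed. [cite: BourbakiAlgebreVIII2012, VIII §20 n°6 Thm 2 Cor 1; DeligneSerreASENS1974, 6.12] -/
theorem stub_residualTriangular :
    ∀ (k₀ k : Type) [Field k₀] [IsAlgClosed k₀] [Field k] (f : k₀ →+* k)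
      (Γ : Type) [Group Γ] (ρ : Γ →* GL (Fin 4) k₀) (σ σ' : Γ →* GL (Fin 2) k),
      Representation.IsIrreducible ((Representation.ofDistribMulAction k (GL (Fin 2) k) (Fin 2 → k)).comp σ) →
      Representation.IsIrreducible ((Representation.ofDistribMulAction k (GL (Fin 2) k) (Fin 2 → k)).comp σ') →
      (∀ g, ((ρ g).val.charpoly).map f = (σ g).val.charpoly * (σ' g).val.charpoly) →
      ∃ (w : GL (Fin 4) k₀) (a d : Γ →* GL (Fin 2) k₀) (b : Γ → Matrix (Fin 2) (Fin 2) k₀),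
        (∀ g, (w⁻¹ * ρ g * w).val =
          Matrix.reindex finSumFinEquiv finSumFinEquiv (Matrix.fromBlocks (a g).val (b g) 0 (d g).val)) ∧
        Representation.IsIrreducible ((Representation.ofDistribMulAction k (GL (Fin 2) k) (Fin 2 → k)).comp
            ((Matrix.GeneralLinearGroup.map f).comp a)) ∧
        Representation.IsIrreducible ((Representation.ofDistribMulAction k (GL (Fin 2) k) (Fin 2 → k)).comp
            ((Matrix.GeneralLinearGroup.map f).comp d)) := by
  sorry

/-- **Stub 2c (Brauer–Nesbitt assembly: block sums of irreducibles with equal characteristic polynomials are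
conjugate).**  `a, d, σ, σ' : Γ → GL₂(k)` irreducible on `k²` with `det(X - a g) det(X - d g) = det(X - σ g) det(X - σ' g)`
for all `g`.  Then `a ⊕ d` and `σ ⊕ σ'` (block diagonal along `finSumFinEquiv`) are conjugate by some `h ∈ GL₄(k)`.
Why true: both block sums are semisimple (`isSemisimpleRepresentation_of_blockDiag`; irreducible ⇒ semisimple) with
equal characteristic polynomials (`Matrix.charpoly_fromBlocks_zero₂₁`), so Brauer–Nesbitt
(`Representation.nonempty_equiv_of_charpoly_eq`, any characteristic) gives an equivalence of the representations on
`k⁴`, i.e. an intertwining invertible matrix.  Size M (~150 lines). [cite: BourbakiAlgebreVIII2012, VIII §20 n°6 Thm 2 Cor 1] -/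
theorem stub_blockSumConj :
    ∀ (k : Type) [Field k] (Γ : Type) [Group Γ] (a d σ σ' : Γ →* GL (Fin 2) k),
      Representation.IsIrreducible ((Representation.ofDistribMulAction k (GL (Fin 2) k) (Fin 2 → k)).comp a) →
      Representation.IsIrreducible ((Representation.ofDistribMulAction k (GL (Fin 2) k) (Fin 2 → k)).comp d) →
      Representation.IsIrreducible ((Representation.ofDistribMulAction k (GL (Fin 2) k) (Fin 2 → k)).comp σ) →
      Representation.IsIrreducible ((Representation.ofDistribMulAction k (GL (Fin 2) k) (Fin 2 → k)).comp σ') →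
      (∀ g, (a g).val.charpoly * (d g).val.charpoly = (σ g).val.charpoly * (σ' g).val.charpoly) →
      ∃ h : GL (Fin 4) k, ∀ g,
        Matrix.reindex finSumFinEquiv finSumFinEquiv (Matrix.fromBlocks (a g).val 0 0 (d g).val) =
          h.val * Matrix.reindex finSumFinEquiv finSumFinEquiv (Matrix.fromBlocks (σ g).val 0 0 (σ' g).val) *
            (h⁻¹).val := by
  sorry

/-- **Stub 2d (the ϖ-trick: block-triangular reduction ⇒ block-diagonal reduction over `ℤ̄_p`).**  Let
`r : Γ_ℚ → GL₄(ℚ̄_p)` be continuous, `rint = P⁻¹ r P` an integral model over `ℤ̄_p = 𝒪_{ℚ̄_p}`, and suppose that after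
a residual change of basis `w ∈ GL₄(κ)` (`κ = ℤ̄_p/𝔪`) the reduction of `rint` is block upper triangular,
`w⁻¹ · (rint g mod 𝔪) · w = (a g, b g; 0, d g)`.  Then some conjugate `rint' = P'⁻¹ r P'` is again integral and has
block DIAGONAL reduction `(a g, 0; 0, d g)`.  Why true: lift `w` to `W ∈ GL₄(ℤ̄_p)` (entrywise lift; `det` is a unit
iff its residue is non-zero) and pass to `W⁻¹ rint W`, whose lower-left block `c(g)` has entries in `𝔪`; by
continuity of `g ↦ P⁻¹ r(g) P` and compactness of `Γ_ℚ`, `λ = sup_g ‖c(g)‖ < 1`; `ℚ̄_p` contains `ϖ = p^{1/N}` with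
`λ ≤ ‖ϖ‖² < 1`, and conjugating by `D = diag(1,1,ϖ,ϖ)` gives `(a, ϖ b; ϖ⁻¹ c, d)`, still `ℤ̄_p`-valued
(`‖ϖ⁻¹ c‖ ≤ λ/‖ϖ‖ ≤ ‖ϖ‖ < 1`) with reduction `(a, 0; 0, d)`; the `GL₄(ℤ̄_p)`-valued homomorphism is assembled with
`exists_monoidHom_map_eq`.  Size M/L (~300 lines).  (Over a discretely valued `𝒪_E` this is the passage to the
ramified quadratic extension `E(√π)`; over `ℤ̄_p` no extension is needed.) [cite: SerreAbelianLadic1968, Ch. I §1.1 Remark 1; BellaicheChenevier2009, §1.5] -/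
theorem stub_splitFrame :
    ∀ (p : ℕ) [Fact p.Prime]
      (r : Literature.NumberTheory.GaloisRepresentations.FramedGaloisRep ℚ (PadicAlgCl p) 4)
      (P : GL (Fin 4) (PadicAlgCl p))
      (rint : Field.absoluteGaloisGroup ℚ →* GL (Fin 4) (Valued.integer (PadicAlgCl p)))
      (w : GL (Fin 4) (IsLocalRing.ResidueField (Valued.integer (PadicAlgCl p))))
      (a b d : Field.absoluteGaloisGroup ℚ →
        Matrix (Fin 2) (Fin 2) (IsLocalRing.ResidueField (Valued.integer (PadicAlgCl p)))),
      (∀ g, Matrix.GeneralLinearGroup.map (Valued.integer (PadicAlgCl p)).subtype (rint g) = P⁻¹ * r g * P) →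
      (∀ g, (w⁻¹ * Matrix.GeneralLinearGroup.map
          (IsLocalRing.residue (Valued.integer (PadicAlgCl p))) (rint g) * w).val =
          Matrix.reindex finSumFinEquiv finSumFinEquiv (Matrix.fromBlocks (a g) (b g) 0 (d g))) →
      ∃ (P' : GL (Fin 4) (PadicAlgCl p))
        (rint' : Field.absoluteGaloisGroup ℚ →* GL (Fin 4) (Valued.integer (PadicAlgCl p))),
        (∀ g, Matrix.GeneralLinearGroup.map (Valued.integer (PadicAlgCl p)).subtype (rint' g) =
          P'⁻¹ * r g * P') ∧
        (∀ g, (Matrix.GeneralLinearGroup.map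
            (IsLocalRing.residue (Valued.integer (PadicAlgCl p))) (rint' g)).val =
          Matrix.reindex finSumFinEquiv finSumFinEquiv (Matrix.fromBlocks (a g) 0 0 (d g))) := by
  sorry

/-! ### Glue facts for the composition: the residue field of `ℤ̄_p` -/

section ResidueFieldGlue

variable {p : ℕ} [Fact p.Prime]

/-- A non-unit of `ℤ̄_p = 𝒪_{ℚ̄_p}` has norm `< 1`. [folklore] -/
theorem norm_lt_one_of_not_isUnit {x : Valued.integer (PadicAlgCl p)} (hx : ¬ IsUnit x) :
    ‖(x : PadicAlgCl p)‖ < 1 := by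
  have h := (Valuation.Integer.not_isUnit_iff_valuation_lt_one (v := Valued.v)).mp hx
  rw [PadicAlgCl.valuation_def] at h
  exact_mod_cast h

/-- Any ring map `red : ℤ̄_p → k` to a field of characteristic `p` kills the elements of norm `< 1`
(`‖x‖^N ≤ ‖p‖`, so `x^N ∈ p ℤ̄_p` and `red(x)^N = 0`).  Re-derived from the crux disprover's
`red_eq_zero_of_norm_lt_one` (Cruxes/ResiduallyYoshidaLifting/Disproof.lean, not importable). [folklore] -/
theorem red_eq_zero_of_norm_lt_one {k : Type*} [Field k] [CharP k p]
    (red : Valued.integer (PadicAlgCl p) →+* k)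
    (x : Valued.integer (PadicAlgCl p)) (hx : ‖(x : PadicAlgCl p)‖ < 1) : red x = 0 := by
  have hp0 : 0 < ‖((p : ℕ) : PadicAlgCl p)‖ :=
    norm_pos_iff.2 (Nat.cast_ne_zero.2 (Fact.out : p.Prime).ne_zero)
  obtain ⟨N, hN⟩ := exists_pow_lt_of_lt_one hp0 hx
  have hz : ‖(x : PadicAlgCl p) ^ N / (p : PadicAlgCl p)‖ ≤ 1 := by
    rw [norm_div, norm_pow]
    exact (div_le_one hp0).2 hN.le
  have hzmem : (x : PadicAlgCl p) ^ N / (p : PadicAlgCl p) ∈ Valued.integer (PadicAlgCl p) := by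
    refine (Valuation.mem_integer_iff _ _).mpr ?_
    rw [PadicAlgCl.valuation_def]
    exact_mod_cast hz
  let z : Valued.integer (PadicAlgCl p) := ⟨_, hzmem⟩
  have hxN : x ^ N = (p : Valued.integer (PadicAlgCl p)) * z := by
    apply Subtype.ext
    change ((x ^ N : Valued.integer (PadicAlgCl p)) : PadicAlgCl p) =
      ((p : Valued.integer (PadicAlgCl p)) : PadicAlgCl p) *
        ((x : PadicAlgCl p) ^ N / (p : PadicAlgCl p))
    have hp0' : (p : PadicAlgCl p) ≠ 0 := norm_pos_iff.1 hp0
    push_cast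
    field_simp
  have h0 : red x ^ N = 0 := by
    rw [← map_pow, hxN, map_mul, map_natCast, CharP.cast_eq_zero, zero_mul]
  exact eq_zero_of_pow_eq_zero h0

/-- Hence `red` kills the maximal ideal of the local ring `ℤ̄_p`. [folklore] -/
theorem red_eq_zero_of_mem_maximalIdeal {k : Type*} [Field k] [CharP k p]
    (red : Valued.integer (PadicAlgCl p) →+* k) {x : Valued.integer (PadicAlgCl p)}
    (hx : x ∈ IsLocalRing.maximalIdeal (Valued.integer (PadicAlgCl p))) : red x = 0 :=
  red_eq_zero_of_norm_lt_one red x (norm_lt_one_of_not_isUnit hx)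

/-- … so `red` is a local homomorphism (it detects units). [folklore] -/
theorem isLocalHom_red {k : Type*} [Field k] [CharP k p]
    (red : Valued.integer (PadicAlgCl p) →+* k) : IsLocalHom red := by
  refine ⟨fun x hx => ?_⟩
  by_contra h
  exact hx.ne_zero (red_eq_zero_of_mem_maximalIdeal red h)

/-- `red` factors through the residue field `ℤ̄_p/𝔪`: `red = f ∘ residue`. [folklore] -/
theorem exists_residueField_factor {k : Type*} [Field k] [CharP k p]
    (red : Valued.integer (PadicAlgCl p) →+* k) :
    ∃ f : IsLocalRing.ResidueField (Valued.integer (PadicAlgCl p)) →+* k,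
      ∀ x, f (IsLocalRing.residue _ x) = red x := by
  haveI := isLocalHom_red red
  exact ⟨IsLocalRing.ResidueField.lift red, fun x => IsLocalRing.ResidueField.lift_residue_apply red x⟩

/-- **The residue field of `ℤ̄_p = 𝒪_{ℚ̄_p}` is algebraically closed**: a monic polynomial over
`ℤ̄_p/𝔪` lifts to a monic polynomial over `ℤ̄_p`, which has a root in the algebraically closed `ℚ̄_p`;
the root is integral over the valuation ring, hence lies in it, and its residue is a root. [folklore] -/
theorem isAlgClosed_residueField :
    IsAlgClosed (IsLocalRing.ResidueField (Valued.integer (PadicAlgCl p))) := by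
  refine IsAlgClosed.of_exists_root _ fun q hq hirr => ?_
  have hsurj : Function.Surjective (IsLocalRing.residue (Valued.integer (PadicAlgCl p))) :=
    Ideal.Quotient.mk_surjective
  obtain ⟨Q, hQ, hdeg, hmonic⟩ :=
    Polynomial.lifts_and_degree_eq_and_monic
      ((Polynomial.mem_lifts q).mpr (Polynomial.map_surjective _ hsurj q)) hq
  have hqdeg : q.degree ≠ 0 := (Polynomial.degree_pos_of_irreducible hirr).ne'
  set QK : Polynomial (PadicAlgCl p) := Q.map (algebraMap (Valued.integer (PadicAlgCl p)) (PadicAlgCl p))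
  have hQKdeg : QK.degree ≠ 0 := by
    rw [hmonic.degree_map, hdeg]
    exact hqdeg
  obtain ⟨α, hα⟩ := IsAlgClosed.exists_root QK hQKdeg
  have hint : IsIntegral (Valued.integer (PadicAlgCl p)) α := by
    refine ⟨Q, hmonic, ?_⟩
    have := hα
    rwa [Polynomial.IsRoot.def, Polynomial.eval_map] at this
  have hαO : α ∈ Valued.integer (PadicAlgCl p) :=
    (Valuation.integer.integers (Valued.v (R := PadicAlgCl p))).mem_of_integral hint
  refine ⟨IsLocalRing.residue _ ⟨α, hαO⟩, ?_⟩
  have h2 : algebraMap (Valued.integer (PadicAlgCl p)) (PadicAlgCl p) (Q.eval ⟨α, hαO⟩) = QK.eval α := by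
    rw [← Polynomial.eval₂_at_apply, ← Polynomial.eval_map]
    rfl
  have h1 : Q.eval ⟨α, hαO⟩ = 0 := by
    have hinj : Function.Injective (algebraMap (Valued.integer (PadicAlgCl p)) (PadicAlgCl p)) :=
      Subtype.val_injective
    apply hinj
    rw [map_zero, h2]
    exact hα
  rw [← hQ, Polynomial.eval_map, Polynomial.eval₂_at_apply, h1, map_zero]

end ResidueFieldGlue

/-- **Stub 2, composed (the planner's registered `stub_residualYoshidaSplitting`, verbatim statement, now a
theorem of this file modulo Stubs 2a–2d).**  For `ρ : Γ_ℚ → GL₄(ℚ̄_p)` whose Frobenius polynomials reduce through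
`red` to `charpoly σ · charpoly σ'` (`σ, σ'` irreducible): a frame `P` in which `ρ` is `ℤ̄_p`-integral with
BLOCK-DIAGONAL reduction `h (σ ⊕ σ') h⁻¹`, `h ∈ GL₄(k)`.  Proof: integral model over the valuation ring `ℤ̄_p`
(`exists_integralModel_of_valuationSubring`); `red = f ∘ (mod 𝔪)` with `κ = ℤ̄_p/𝔪` algebraically closed; Stub 2a
gives the characteristic polynomials of the reduction; Stub 2b a residual basis making it block triangular with
irreducible diagonal blocks; Stub 2d a new frame with block diagonal reduction; Stub 2c conjugates the diagonal
blocks (through `f`) to `σ ⊕ σ'`. [cite: BellaicheChenevier2009, §1.5; Ribet1976, Prop. 2.1; SerreAbelianLadic1968, I §1.1] -/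
theorem residualYoshidaSplitting_of_stubs :
    ∀ (p : ℕ) [Fact p.Prime], p ≠ 2 → ∀ (k : Type) [Field k] [CharP k p] [IsAlgClosed k]
      [TopologicalSpace k] [DiscreteTopology k] (red : Valued.integer (PadicAlgCl p) →+* k)
      (σ σ' : Literature.NumberTheory.GaloisRepresentations.FramedGaloisRep ℚ k 2)
      (r : Literature.NumberTheory.GaloisRepresentations.FramedGaloisRep ℚ (PadicAlgCl p) 4),
      let εb : Field.absoluteGaloisGroup ℚ →* (ZMod p)ˣ :=
        (modularCyclotomicCharacter (AlgebraicClosure ℚ)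
          (HasEnoughRootsOfUnity.natCard_rootsOfUnity (AlgebraicClosure ℚ) p)).comp
          (MulSemiringAction.toRingAut (Field.absoluteGaloisGroup ℚ) (AlgebraicClosure ℚ))
      σ.toGaloisRep.IsIrreducible → σ'.toGaloisRep.IsIrreducible →
      (∀ g, Literature.NumberTheory.GaloisRepresentations.FramedRep.det σ g =
          (Units.map (ZMod.castHom (dvd_refl p) k).toMonoidHom (εb g))⁻¹ ∧
        Literature.NumberTheory.GaloisRepresentations.FramedRep.det σ' g =
          Literature.NumberTheory.GaloisRepresentations.FramedRep.det σ g) →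
      (¬ ∃ g : GL (Fin 2) k, ∀ x, g * σ x * g⁻¹ = σ' x) →
      r.toGaloisRep.IsIrreducible →
      r.IsSymplecticWithMultiplierFun (fun g => algebraMap ℚ_[p] (PadicAlgCl p)
        ((((Literature.NumberTheory.GaloisRepresentations.GaloisRep.cyclotomicCharacter ℚ p g)⁻¹ :
          ℤ_[p]ˣ) : ℤ_[p]) : ℚ_[p])) →
      (∀ᶠ v : IsDedekindDomain.HeightOneSpectrum (NumberField.RingOfIntegers ℚ) in Filter.cofinite,
        r.IsUnramifiedAt v ∧ σ.IsUnramifiedAt v ∧ σ'.IsUnramifiedAt v ∧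
        ∃ (P : Polynomial (Valued.integer (PadicAlgCl p))) (P₁ P₂ : Polynomial k),
          r.HasFrobCharpolyAt v (P.map (Valued.integer (PadicAlgCl p)).subtype) ∧
          σ.HasFrobCharpolyAt v P₁ ∧ σ'.HasFrobCharpolyAt v P₂ ∧ P.map red = P₁ * P₂) →
      ∃ (P : GL (Fin 4) (PadicAlgCl p))
        (rint : Field.absoluteGaloisGroup ℚ →* GL (Fin 4) (Valued.integer (PadicAlgCl p)))
        (h : GL (Fin 4) k),
        (∀ g, Matrix.GeneralLinearGroup.map (Valued.integer (PadicAlgCl p)).subtype (rint g) =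
          P⁻¹ * r g * P) ∧
        (∀ g, (Matrix.GeneralLinearGroup.map red (rint g)).val =
          h.val * Matrix.reindex finSumFinEquiv finSumFinEquiv
            (Matrix.fromBlocks (σ g).val 0 0 (σ' g).val) * (h⁻¹).val) := by
  intro p _ hp k _ _ _ _ _ red σ σ' r εb hσirr hσ'irr _hdet _hnc _hrirr _hsymp hae
  classical
  -- (G4) an integral model over the valuation ring `ℤ̄_p` (non-noetherian: Serre's remark, Bézout form)
  obtain ⟨P, rint₀, hP⟩ : ∃ (P : GL (Fin 4) (PadicAlgCl p))
      (rint₀ : Field.absoluteGaloisGroup ℚ →* GL (Fin 4) (Valued.integer (PadicAlgCl p))),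
      ∀ g, Matrix.GeneralLinearGroup.map (Valued.integer (PadicAlgCl p)).subtype (rint₀ g) =
        P⁻¹ * r g * P :=
    exists_integralModel_of_valuationSubring (Valued.isOpen_valuationSubring (PadicAlgCl p)) r
  -- (G1) `red = f ∘ residue`, (G2) the residue field `κ` is algebraically closed
  obtain ⟨f, hf⟩ := exists_residueField_factor red
  haveI : IsAlgClosed (IsLocalRing.ResidueField (Valued.integer (PadicAlgCl p))) :=
    isAlgClosed_residueField
  have hfres : f.comp (IsLocalRing.residue (Valued.integer (PadicAlgCl p))) = red :=
    RingHom.ext hf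
  -- Stub 2a: characteristic polynomials of the reduction, for every `g`
  have hchar := stub_residualCharpoly p k red σ σ' r P rint₀ hP hae
  -- the reduction `ρ̄ : Γ_ℚ → GL₄(κ)`
  set ρbar : Field.absoluteGaloisGroup ℚ →* GL (Fin 4) (IsLocalRing.ResidueField (Valued.integer (PadicAlgCl p))) :=
    (Matrix.GeneralLinearGroup.map (IsLocalRing.residue (Valued.integer (PadicAlgCl p)))).comp rint₀
    with hρbar
  have hρbar_val : ∀ g, (ρbar g).val =
      (rint₀ g).val.map (IsLocalRing.residue (Valued.integer (PadicAlgCl p))) := fun g => rfl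
  have hcharbar : ∀ g, ((ρbar g).val.charpoly).map f = (σ g).val.charpoly * (σ' g).val.charpoly := by
    intro g
    rw [hρbar_val, Matrix.charpoly_map, Polynomial.map_map, hfres]
    exact hchar g
  -- Stub 2b: block upper triangular form over `κ`, irreducible diagonal blocks over `k`
  obtain ⟨w, a, d, b, hw, hairr, hdirr⟩ :=
    stub_residualTriangular (IsLocalRing.ResidueField (Valued.integer (PadicAlgCl p))) k f
      (Field.absoluteGaloisGroup ℚ) ρbar σ.toMonoidHom σ'.toMonoidHom hσirr hσ'irr hcharbar
  -- Stub 2d: a new frame with block DIAGONAL reduction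
  obtain ⟨P', rint', hP', hred'⟩ :=
    stub_splitFrame p r P rint₀ w (fun g => (a g).val) (fun g => b g) (fun g => (d g).val) hP hw
  -- Stub 2c: conjugate the diagonal blocks (through `f`) to `σ ⊕ σ'`
  have hmapval : ∀ (u : GL (Fin 2) (IsLocalRing.ResidueField (Valued.integer (PadicAlgCl p)))),
      (Matrix.GeneralLinearGroup.map f u).val = u.val.map f := fun u => rfl
  have hprod : ∀ g, ((Matrix.GeneralLinearGroup.map f).comp a g).val.charpoly *
      ((Matrix.GeneralLinearGroup.map f).comp d g).val.charpoly =
        (σ.toMonoidHom g).val.charpoly * (σ'.toMonoidHom g).val.charpoly := by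
    intro g
    change _ = (σ g).val.charpoly * (σ' g).val.charpoly
    rw [MonoidHom.comp_apply, MonoidHom.comp_apply, hmapval, hmapval, Matrix.charpoly_map,
      Matrix.charpoly_map, ← Polynomial.map_mul, ← hcharbar g]
    congr 1
    have h1 : ((w⁻¹ * ρbar g * w).val).charpoly = (ρbar g).val.charpoly := by
      rw [Units.val_mul, Units.val_mul, Matrix.coe_units_inv]
      exact Matrix.charpoly_units_conj' w _
    rw [← h1, hw g, Matrix.charpoly_reindex, Matrix.charpoly_fromBlocks_zero₂₁]
  obtain ⟨h, hh⟩ := stub_blockSumConj k (Field.absoluteGaloisGroup ℚ)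
    ((Matrix.GeneralLinearGroup.map f).comp a) ((Matrix.GeneralLinearGroup.map f).comp d)
    σ.toMonoidHom σ'.toMonoidHom hairr hdirr hσirr hσ'irr hprod
  refine ⟨P', rint', h, hP', fun g => ?_⟩
  have hred_val : (Matrix.GeneralLinearGroup.map red (rint' g)).val =
      ((Matrix.GeneralLinearGroup.map (IsLocalRing.residue (Valued.integer (PadicAlgCl p)))
        (rint' g)).val).map f := by
    rw [← hfres]
    rfl
  rw [hred_val, hred' g]
  have hh' := hh g
  rw [MonoidHom.comp_apply, MonoidHom.comp_apply, hmapval, hmapval] at hh'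
  have hmap : ∀ M : Matrix (Fin 2 ⊕ Fin 2) (Fin 2 ⊕ Fin 2)
      (IsLocalRing.ResidueField (Valued.integer (PadicAlgCl p))),
      (Matrix.reindex finSumFinEquiv finSumFinEquiv M).map f =
        Matrix.reindex finSumFinEquiv finSumFinEquiv (M.map f) := fun M => rfl
  rw [hmap, Matrix.fromBlocks_map, Matrix.map_zero _ (map_zero f)]
  exact hh'

/-! ## Stub 3 — the lever: `R_P = 𝕋_P` data at an endoscopic–stable crossing prime (Wiles–Lenstra form) -/

/-- **Stub 3 (Yoshida crossing `R = 𝕋` package; HARDEST — the line's bet).**  Under the crux hypotheses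
(same `red`, `σ`, `σ'`; `ρ₀` automorphic; split integral frames of `ρ₀` and `ρ` from Stub 2) there exist:
a finite set `S` of places (tame level: ramification of `ρ`, `ρ₀`, plus the auxiliary level-raising primes
`q ≡ -1 (p)`, `Frob_q ∼ c`, forced by Hsieh–Palvannan's hypothesis (yos)); a coefficient ring `𝒪` with
residue field `k' → k` (finite, say) over which `σ̄ ⊕ σ̄'` descends to `rbar` (up to `hb ∈ GL₄(k)`: `σ`, `σ'`
need not have entries in `𝔽̄_p`), a lifting condition `𝒞` on lifts of `rbar` (INTENDED: `GSp₄`-valued with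
multiplier deforming `ε̄⁻¹`, nearly ordinary at `p` along the residually distinguished flag with free
diagonal inertial characters — the Λ-adic family —, unramified outside `S`; tree
`Deformation.LiftingCondition`) together with its UNIVERSAL ring `R ∈ Ĉ_𝒪(k')` and universal lift `ρR`
(the universal property is a typed conjunct; Mazur/Schlessinger, tree `exists_universal_of_finite` for
finite `k'`, the split frames of Stub 2 make `ρ`, `ρ₀` points), `𝒯 = tr ρR`; the big ordinary Hecke
algebra `𝕋` at the Yoshida maximal ideal with `φ : R ↠ 𝕋` (`R ↠ 𝕋` by Chebotarev density of Frobenius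
traces; Galois representations over `𝕋` glued from Taylor1991 / Weissauer pseudo-representations), and
the point `x = x_ρ` (`x ∘ 𝒯 = tr ρ`); a height-one prime `P` of the Yoshida locus `Y = V(I) ≅ Spf 𝕀_F ⊗̂ 𝕀_G` (`GL₂`
`R^{ord} = 𝕋` for `σ̄`, `σ̄'` + Hsieh–Palvannan Thm (thm:yoshidafamily): `𝕋_Y ≅ 𝕀_{F,G}`) such that
(CROSSING) the irreducible component of `x_ρ` passes through `P` — `ker(R → R_P^∧) ≤ ker x_ρ` — and, after
localising and completing at `P` and choosing Cohen sections (`O' = (R/I)_P^∧ ≅ K⟦t⟧` or mixed, `R' = R_P^∧`,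
`T' = 𝕋_P^∧` finite free over `O'` by depth `≥ 1` and prime avoidance, `π'` the Yoshida augmentation),
(INEQUALITY) `length_{O'} Φ_{R'} ≤ length_{O'} Ψ_{T'}` — the Rankin–Selberg main conjecture in Wiles–Lenstra
form: `length I_P/I_P² ≤ length (B ⊗ C)_P ≤ ord_P char Sel^∨ ≤ ord_P θ_{F,G}` (GMA reducibility ideal
`I = BC`, `B ≅ C`, Bellaïche–Chenevier 1.5; Beilinson–Flach Euler-system divisibility, Kings–Loeffler–Zerbes Thm 11.6.4 / its 3-variable
form) and `ord_P θ_{F,G} ≤ ord_P 𝒞_{Yos} = length Ψ_P` (Hsieh–Liu, announced HP2025 §1.5, UNPUBLISHED);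
and (DENSITY + CONTROL) every point `y` of `𝕋` descending `x` is a `p`-adic limit of points `y'` of `𝕋`
whose pseudocharacters `y' ∘ φ ∘ 𝒯` are traces of `GSp`-valued, Greenberg-ordinary regular-weight, tame
level `S` representations that are automorphic (cuspidal on `GL₄`) or endoscopic (Yoshida: sum of two
2-dimensional traces) — Hida control for `GSp₄` in regular weight, Galois representations of Siegel
eigenforms, continuity of roots along the scalar-weight line through `(2,2)` (finite torsion-free over
`ℤ_p⟦s⟧[1/p]`, a PID).  Why it might be provable: every arrow is in print except `θ ∣ 𝒞`; why it might fail: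
`θ ∤ 𝒞` at some `P` (falsifier: a published pair with `p ∣ L_alg(f ⊗ g)` and no stable congruence), `(BI)`
big-image / `p ≥ 5` inputs of the Euler system fail in the small-image sub-sector the crux still covers,
`I` not principal near `P` (crossing in codimension one needs `h = 1` or Grothendieck connectedness,
triage r1-2 (i)).  Size: open (XL⁺).
[cite: HsiehPalvannan2025, Thm thm:yoshidafamily, Thm thm:mainconj2, §1.5 p. 9; KingsLoefflerZerbes2015, Thm 11.6.4;
BellaicheChenevier2009, Thm 1.5.5; SkinnerWiles1999, §3; AllenNewtonThorne2020, Prop. 5.3] -/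
theorem stub_yoshidaCrossingRT :
    ∀ (p : ℕ) [Fact p.Prime], p ≠ 2 → ∀ (k : Type) [Field k] [CharP k p] [IsAlgClosed k]
      [TopologicalSpace k] [DiscreteTopology k] (red : Valued.integer (PadicAlgCl p) →+* k)
      (σ σ' : Literature.NumberTheory.GaloisRepresentations.FramedGaloisRep ℚ k 2)
      (hcpt : Literature.NumberTheory.Automorphic.isCompact_glFiniteIntegralLevel 4 ℚ)
      (ι : PadicAlgCl p ≃+* ℂ)
      (ρ₀ ρ : Literature.NumberTheory.GaloisRepresentations.FramedGaloisRep ℚ (PadicAlgCl p) 4),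
      let εb : Field.absoluteGaloisGroup ℚ →* (ZMod p)ˣ :=
        (modularCyclotomicCharacter (AlgebraicClosure ℚ)
          (HasEnoughRootsOfUnity.natCard_rootsOfUnity (AlgebraicClosure ℚ) p)).comp
          (MulSemiringAction.toRingAut (Field.absoluteGaloisGroup ℚ) (AlgebraicClosure ℚ))
      let Aut := fun r : Literature.NumberTheory.GaloisRepresentations.FramedGaloisRep ℚ (PadicAlgCl p) 4 =>
        (∃ π : Literature.NumberTheory.Automorphic.CuspidalAutomorphicRepData 4 ℚ hcpt, π.1.IsLAlgebraic ∧
          ∀ᶠ v : IsDedekindDomain.HeightOneSpectrum (NumberField.RingOfIntegers ℚ) in Filter.cofinite,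
            ∃ a : Multiset ℂ, π.1.HasSatakeParamAt v a ∧ r.IsUnramifiedAt v ∧
              r.HasFrobCharpolyAt v
                (Literature.NumberTheory.Automorphic.arithFrobPolyOfSatake ι v.residueCard 1 a))
      let Sh := fun r : Literature.NumberTheory.GaloisRepresentations.FramedGaloisRep ℚ (PadicAlgCl p) 4 =>
        (r.IsSymplecticWithMultiplierFun (fun g => algebraMap ℚ_[p] (PadicAlgCl p)
          ((((Literature.NumberTheory.GaloisRepresentations.GaloisRep.cyclotomicCharacter ℚ p g)⁻¹ :
            ℤ_[p]ˣ) : ℤ_[p]) : ℚ_[p])) ∧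
        (∀ v : IsDedekindDomain.HeightOneSpectrum (NumberField.RingOfIntegers ℚ),
          ((p : ℕ) : NumberField.RingOfIntegers ℚ) ∈ v.asIdeal →
            r.IsGreenbergOrdinaryOfShapeAt v ![0, 0, 1, 1] ∧ r.IsResiduallyDistinguishedAt v ![0, 0, 1, 1]) ∧
        (∀ᶠ v : IsDedekindDomain.HeightOneSpectrum (NumberField.RingOfIntegers ℚ) in Filter.cofinite,
          r.IsUnramifiedAt v ∧ σ.IsUnramifiedAt v ∧ σ'.IsUnramifiedAt v ∧
          ∃ (P : Polynomial (Valued.integer (PadicAlgCl p))) (P₁ P₂ : Polynomial k),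
            r.HasFrobCharpolyAt v (P.map (Valued.integer (PadicAlgCl p)).subtype) ∧
            σ.HasFrobCharpolyAt v P₁ ∧ σ'.HasFrobCharpolyAt v P₂ ∧ P.map red = P₁ * P₂))
      let Endo := fun r : Literature.NumberTheory.GaloisRepresentations.FramedGaloisRep ℚ (PadicAlgCl p) 4 =>
        (∃ r₁ r₂ : Literature.NumberTheory.GaloisRepresentations.FramedGaloisRep ℚ (PadicAlgCl p) 2,
          ∀ g, (r g).val.trace = (r₁ g).val.trace + (r₂ g).val.trace)
      let OrdLevel := fun (S : Finset (IsDedekindDomain.HeightOneSpectrum (NumberField.RingOfIntegers ℚ)))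
          (r : Literature.NumberTheory.GaloisRepresentations.FramedGaloisRep ℚ (PadicAlgCl p) 4) =>
        ((∃ a : Fin 4 → ℕ, StrictMono a ∧
            ∀ v : IsDedekindDomain.HeightOneSpectrum (NumberField.RingOfIntegers ℚ),
              ((p : ℕ) : NumberField.RingOfIntegers ℚ) ∈ v.asIdeal → r.IsGreenbergOrdinaryOfShapeAt v a) ∧
          (∀ v : IsDedekindDomain.HeightOneSpectrum (NumberField.RingOfIntegers ℚ),
            ((p : ℕ) : NumberField.RingOfIntegers ℚ) ∉ v.asIdeal → v ∉ S → r.IsUnramifiedAt v) ∧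
          (∃ ν : Field.absoluteGaloisGroup ℚ → PadicAlgCl p, r.IsSymplecticWithMultiplierFun ν))
      let SplitFrame := fun r : Literature.NumberTheory.GaloisRepresentations.FramedGaloisRep ℚ (PadicAlgCl p) 4 =>
        (∃ (P : GL (Fin 4) (PadicAlgCl p))
          (rint : Field.absoluteGaloisGroup ℚ →* GL (Fin 4) (Valued.integer (PadicAlgCl p)))
          (h : GL (Fin 4) k),
          (∀ g, Matrix.GeneralLinearGroup.map (Valued.integer (PadicAlgCl p)).subtype (rint g) =
            P⁻¹ * r g * P) ∧
          (∀ g, (Matrix.GeneralLinearGroup.map red (rint g)).val =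
            h.val * Matrix.reindex finSumFinEquiv finSumFinEquiv
              (Matrix.fromBlocks (σ g).val 0 0 (σ' g).val) * (h⁻¹).val))
      σ.toGaloisRep.IsIrreducible → σ'.toGaloisRep.IsIrreducible →
      (∀ g, Literature.NumberTheory.GaloisRepresentations.FramedRep.det σ g =
          (Units.map (ZMod.castHom (dvd_refl p) k).toMonoidHom (εb g))⁻¹ ∧
        Literature.NumberTheory.GaloisRepresentations.FramedRep.det σ' g =
          Literature.NumberTheory.GaloisRepresentations.FramedRep.det σ g) →
      (¬ ∃ g : GL (Fin 2) k, ∀ x, g * σ x * g⁻¹ = σ' x) →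
      ρ₀.toGaloisRep.IsIrreducible → Sh ρ₀ → Aut ρ₀ → ρ.toGaloisRep.IsIrreducible → Sh ρ →
      SplitFrame ρ₀ → SplitFrame ρ →
      ∃ (S : Finset (IsDedekindDomain.HeightOneSpectrum (NumberField.RingOfIntegers ℚ)))
        (𝒪 : Type) (_ : CommRing 𝒪) (k' : Type) (_ : Field k') (_ : Algebra 𝒪 k') (jk : k' →+* k)
        (rbar : Field.absoluteGaloisGroup ℚ →* GL (Fin 4) k') (hb : GL (Fin 4) k)
        (𝒞 : Literature.NumberTheory.GaloisRepresentations.Deformation.LiftingCondition 𝒪 k'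
          (Field.absoluteGaloisGroup ℚ) 4 rbar)
        (R : Literature.NumberTheory.GaloisRepresentations.Deformation.CNLAlgebra 𝒪 k')
        (ρR : Field.absoluteGaloisGroup ℚ →* GL (Fin 4) R)
        (𝕋 : Type) (_ : CommRing 𝕋)
        (φ : R →+* 𝕋) (𝒯 : Field.absoluteGaloisGroup ℚ → R) (x : R →+* PadicAlgCl p)
        (O' : Type) (_ : CommRing O') (_ : IsDomain O') (_ : IsDiscreteValuationRing O')
        (_ : IsAdicComplete (IsLocalRing.maximalIdeal O') O')
        (R' : Type) (_ : CommRing R') (_ : IsLocalRing R') (_ : IsNoetherianRing R')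
        (_ : IsAdicComplete (IsLocalRing.maximalIdeal R') R') (_ : Algebra O' R')
        (T' : Type) (_ : CommRing T') (_ : IsLocalRing T') (_ : Algebra O' T') (_ : Module.Finite O' T')
        (_ : Module.Free O' T')
        (φ' : R' →ₐ[O'] T') (π' : T' →ₐ[O'] O') (ιR : R →+* R') (ιT : 𝕋 →+* T'),
        (∀ g, (Matrix.GeneralLinearGroup.map jk (rbar g)).val =
          hb.val * Matrix.reindex finSumFinEquiv finSumFinEquiv
            (Matrix.fromBlocks (σ g).val 0 0 (σ' g).val) * (hb⁻¹).val) ∧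
        ρR ∈ 𝒞.carrier R ∧
        (∀ (A : Literature.NumberTheory.GaloisRepresentations.Deformation.CNLAlgebra 𝒪 k')
            (ρA : Field.absoluteGaloisGroup ℚ →* GL (Fin 4) A), ρA ∈ 𝒞.carrier A →
            ∃! ψ : R →ₐ[𝒪] A, (Matrix.GeneralLinearGroup.map (ψ : R →+* A)).comp ρR = ρA) ∧
        (∀ g, 𝒯 g = (ρR g).val.trace) ∧
        Function.Surjective φ ∧
        (∀ g, x (𝒯 g) = (ρ g).val.trace) ∧
        Function.Surjective φ' ∧ congruenceIdeal π' ≠ ⊥ ∧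
        Module.length O' (CotangentModule (π'.comp φ')) ≤ Module.length O' (CongruenceModule π') ∧
        (∀ a, ιT (φ a) = φ' (ιR a)) ∧
        RingHom.ker ιR ≤ RingHom.ker x ∧
        (∀ y : 𝕋 →+* PadicAlgCl p, y.comp φ = x → ∀ n : ℕ,
          ∃ (y' : 𝕋 →+* PadicAlgCl p)
            (r' : Literature.NumberTheory.GaloisRepresentations.FramedGaloisRep ℚ (PadicAlgCl p) 4),
            (Aut r' ∨ Endo r') ∧ OrdLevel S r' ∧ (∀ g, y' (φ (𝒯 g)) = (r' g).val.trace) ∧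
            ∀ t, ‖y' t - y t‖ ≤ (p : ℝ) ^ (-(n : ℤ))) := by
  sorry

/-! ## Stub 4 — weight-(2,2) classicality at an endoscopic maximal ideal, Galois-theoretic form -/

/-- **Stub 4 (weight-(2,2) classicality + transfer AT THE YOSHIDA MAXIMAL IDEAL; open, shared debt of every line).**
RESHAPED by the lead (cycle 1, after the wave-1 worker's `stub-misstated`, = Disproof T4(a) for this line):
the residual data `k, red, σ̄, σ̄'` and the crux's residual hypotheses (odd, irreducible, `det = ε̄⁻¹`,
non-conjugate, a.e. factorisation `charpoly ρ(Frob_v) ≡ charpoly σ̄ · charpoly σ̄'`) are now hypotheses — the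
glue holds them anyway — so that the stub asserts classicality at the Yoshida 𝔪 of `(σ̄, σ̄')` only and is
IMPLIED BY THE ROUTE TARGET `PhantomRMSector` (kernel-checked by the worker: evidence
`StubWeightTwoClassicality.lean`, `weightTwoClassicalityRes_of_phantomRMSector`): no risk beyond the target.  Let
`ρ : Γ_ℚ → GL₄(ℚ̄_p)` be irreducible, symplectic with multiplier `ε⁻¹`, Greenberg-ordinary of shape
`(0,0,1,1)` and residually distinguished at `p`, and ORDINARILY PRO-AUTOMORPHIC OF TAME LEVEL `S`: for every
`n`, `tr ρ ≡ tr ρ' (mod p^n)` uniformly on `Γ_ℚ` for some `GSp`-valued `ρ'`, Greenberg-ordinary of some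
REGULAR shape at `p`, unramified outside `S ∪ {p}`, which is automorphic (cuspidal `L`-algebraic `π'` on
`GL₄(𝔸_ℚ)`, Satake = Frobenius a.e.) or endoscopic (its trace is the sum of the traces of two 2-dimensional
representations).  Then `ρ` is automorphic.  Why plausible: the hypothesis says exactly that `tr ρ` is an
`O`-point in weight `(2,2)` of the big ordinary cuspidal Hecke algebra of `GSp₄` of tame level `S`
(compactness of `𝕋`; limits of endoscopic traces are endoscopic, excluded by irreducibility + Taylor's
pseudocharacter theorem, tree `exists_semisimple_rep_of_isPseudocharacter`); BCGP higher Hida theory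
(BoxerEtAl2021 §4–7, Pilloni2020) puts a `p`-distinguished ordinary weight-`(2,2)` eigensystem in classical
`e(H⁰ ⊕ H¹)(X, ω²(-D))`, giving a cuspidal `π` on `GSp₄` with `π_∞` a limit of discrete series, of general
type since `ρ_π = ρ` is irreducible, whose transfer to `GL₄` is cuspidal (Arthur 2013 / Gee–Taïbi 2019).
Why it might fail: the printed vanishing / doubling arguments assume residually big image; at a Yoshida
`𝔪` endoscopic `H¹` is non-zero (NonRegularWeightBarrier, coherent evasion (i) only).  Size: open (XL⁺).
[cite: BoxerEtAl2021, §4–§7; BoxerCalegariGeePilloni2025; Pilloni2020; GeeTaibi2019; Arthur2013;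
Taylor1991] -/
theorem stub_weightTwoClassicality :
    ∀ (p : ℕ) [Fact p.Prime], p ≠ 2 → ∀ (k : Type) [Field k] [CharP k p] [IsAlgClosed k]
      [TopologicalSpace k] [DiscreteTopology k] (red : Valued.integer (PadicAlgCl p) →+* k)
      (σ σ' : Literature.NumberTheory.GaloisRepresentations.FramedGaloisRep ℚ k 2)
      (hcpt : Literature.NumberTheory.Automorphic.isCompact_glFiniteIntegralLevel 4 ℚ)
      (ι : PadicAlgCl p ≃+* ℂ)
      (S : Finset (IsDedekindDomain.HeightOneSpectrum (NumberField.RingOfIntegers ℚ)))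
      (ρ : Literature.NumberTheory.GaloisRepresentations.FramedGaloisRep ℚ (PadicAlgCl p) 4),
      let εb : Field.absoluteGaloisGroup ℚ →* (ZMod p)ˣ :=
        (modularCyclotomicCharacter (AlgebraicClosure ℚ)
          (HasEnoughRootsOfUnity.natCard_rootsOfUnity (AlgebraicClosure ℚ) p)).comp
          (MulSemiringAction.toRingAut (Field.absoluteGaloisGroup ℚ) (AlgebraicClosure ℚ))
      let Aut := fun r : Literature.NumberTheory.GaloisRepresentations.FramedGaloisRep ℚ (PadicAlgCl p) 4 =>
        (∃ π : Literature.NumberTheory.Automorphic.CuspidalAutomorphicRepData 4 ℚ hcpt, π.1.IsLAlgebraic ∧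
          ∀ᶠ v : IsDedekindDomain.HeightOneSpectrum (NumberField.RingOfIntegers ℚ) in Filter.cofinite,
            ∃ a : Multiset ℂ, π.1.HasSatakeParamAt v a ∧ r.IsUnramifiedAt v ∧
              r.HasFrobCharpolyAt v
                (Literature.NumberTheory.Automorphic.arithFrobPolyOfSatake ι v.residueCard 1 a))
      let Endo := fun r : Literature.NumberTheory.GaloisRepresentations.FramedGaloisRep ℚ (PadicAlgCl p) 4 =>
        (∃ r₁ r₂ : Literature.NumberTheory.GaloisRepresentations.FramedGaloisRep ℚ (PadicAlgCl p) 2,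
          ∀ g, (r g).val.trace = (r₁ g).val.trace + (r₂ g).val.trace)
      let OrdLevel := fun (S : Finset (IsDedekindDomain.HeightOneSpectrum (NumberField.RingOfIntegers ℚ)))
          (r : Literature.NumberTheory.GaloisRepresentations.FramedGaloisRep ℚ (PadicAlgCl p) 4) =>
        ((∃ a : Fin 4 → ℕ, StrictMono a ∧
            ∀ v : IsDedekindDomain.HeightOneSpectrum (NumberField.RingOfIntegers ℚ),
              ((p : ℕ) : NumberField.RingOfIntegers ℚ) ∈ v.asIdeal → r.IsGreenbergOrdinaryOfShapeAt v a) ∧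
          (∀ v : IsDedekindDomain.HeightOneSpectrum (NumberField.RingOfIntegers ℚ),
            ((p : ℕ) : NumberField.RingOfIntegers ℚ) ∉ v.asIdeal → v ∉ S → r.IsUnramifiedAt v) ∧
          (∃ ν : Field.absoluteGaloisGroup ℚ → PadicAlgCl p, r.IsSymplecticWithMultiplierFun ν))
      σ.IsOdd → σ'.IsOdd → σ.toGaloisRep.IsIrreducible → σ'.toGaloisRep.IsIrreducible →
      (∀ g, Literature.NumberTheory.GaloisRepresentations.FramedRep.det σ g =
          (Units.map (ZMod.castHom (dvd_refl p) k).toMonoidHom (εb g))⁻¹ ∧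
        Literature.NumberTheory.GaloisRepresentations.FramedRep.det σ' g =
          Literature.NumberTheory.GaloisRepresentations.FramedRep.det σ g) →
      (¬ ∃ g : GL (Fin 2) k, ∀ x, g * σ x * g⁻¹ = σ' x) →
      ρ.toGaloisRep.IsIrreducible →
      ρ.IsSymplecticWithMultiplierFun (fun g => algebraMap ℚ_[p] (PadicAlgCl p)
        ((((Literature.NumberTheory.GaloisRepresentations.GaloisRep.cyclotomicCharacter ℚ p g)⁻¹ :
          ℤ_[p]ˣ) : ℤ_[p]) : ℚ_[p])) →
      (∀ v : IsDedekindDomain.HeightOneSpectrum (NumberField.RingOfIntegers ℚ),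
        ((p : ℕ) : NumberField.RingOfIntegers ℚ) ∈ v.asIdeal →
          ρ.IsGreenbergOrdinaryOfShapeAt v ![0, 0, 1, 1] ∧ ρ.IsResiduallyDistinguishedAt v ![0, 0, 1, 1]) →
      (∀ᶠ v : IsDedekindDomain.HeightOneSpectrum (NumberField.RingOfIntegers ℚ) in Filter.cofinite,
        ρ.IsUnramifiedAt v ∧ σ.IsUnramifiedAt v ∧ σ'.IsUnramifiedAt v ∧
        ∃ (P : Polynomial (Valued.integer (PadicAlgCl p))) (P₁ P₂ : Polynomial k),
          ρ.HasFrobCharpolyAt v (P.map (Valued.integer (PadicAlgCl p)).subtype) ∧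
          σ.HasFrobCharpolyAt v P₁ ∧ σ'.HasFrobCharpolyAt v P₂ ∧ P.map red = P₁ * P₂) →
      (∀ n : ℕ, ∃ r' : Literature.NumberTheory.GaloisRepresentations.FramedGaloisRep ℚ (PadicAlgCl p) 4,
        (Aut r' ∨ Endo r') ∧ OrdLevel S r' ∧
          ∀ g, ‖(r' g).val.trace - (ρ g).val.trace‖ ≤ (p : ℝ) ^ (-(n : ℤ))) →
      Aut ρ := by
  sorry

/-! ## Glue (sorry-free): the crux from the four stubs -/

/-- **`ResiduallyYoshidaLifting` from the line `endoscopic-crossing-euler`.**  Split frames (Stub 2, for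
`ρ₀` and `ρ`) ⟶ the crossing `R = 𝕋` package (Stub 3) ⟶ numerical criterion (Stub 1): `φ' : R_P^∧ → 𝕋_P^∧`
is bijective ⟶ propagation `ker φ ≤ ker ιR ≤ ker x_ρ`, so `x_ρ` descends to a point `y` of `𝕋` ⟶ density
and control at `y`: `tr ρ` is a `p`-adic limit of automorphic-or-endoscopic ordinary regular-weight traces
of tame level `S` ⟶ classicality (Stub 4). -/
theorem ResiduallyYoshidaLifting_of :
    Summit.Langlands.Langlands.Theses.PhantomRMYoshida.ResiduallyYoshidaLifting := by
  refine fun p _ hp k _ _ _ _ _ red σ σ' hcpt ι ρ₀ ρ hσ hσ' hirr hirr' hdet hnc hρ₀irr hSh₀ hAut₀ hρirr hSh => ?_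
  -- Stub 2: integral frames of `ρ₀` and `ρ` with split reduction `σ ⊕ σ'`
  obtain ⟨P₀, r₀int, h₀, hP₀, hred₀⟩ :=
    residualYoshidaSplitting_of_stubs p hp k red σ σ' ρ₀ hirr hirr' hdet hnc hρ₀irr hSh₀.1 hSh₀.2.2
  obtain ⟨P, rint, h, hP, hred⟩ :=
    residualYoshidaSplitting_of_stubs p hp k red σ σ' ρ hirr hirr' hdet hnc hρirr hSh.1 hSh.2.2
  -- Stub 3: the crossing `R = 𝕋` package at a height-one prime of the Yoshida locus
  obtain ⟨S, 𝒪, _, k', _, _, jk, rbar, hb, 𝒞, R, ρR, 𝕋, _, φ, 𝒯, x, O', _, _, _, _, R', _, _, _, _, _,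
      T', _, _, _, _, _, φ', π', ιR, ιT,
      -, -, -, -, hφ, hx, hφ', hη, hle, hcomm, hcross, hdens⟩ :=
    stub_yoshidaCrossingRT p hp k red σ σ' hcpt ι ρ₀ ρ hirr hirr' hdet hnc hρ₀irr hSh₀ hAut₀ hρirr hSh
      ⟨P₀, r₀int, h₀, hP₀, hred₀⟩ ⟨P, rint, h, hP, hred⟩
  -- Stub 1: the numerical criterion over the complete DVR `O'` makes `φ' : R' → T'` bijective
  have hbij : Function.Bijective φ' := stub_numericalCriterion O' R' T' φ' π' hφ' hη hle
  -- propagation: `ker φ ≤ ker ιR ≤ ker x` (commuting square + crossing)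
  have hker : RingHom.ker φ ≤ RingHom.ker x := by
    intro a ha
    apply hcross
    rw [RingHom.mem_ker] at ha ⊢
    apply hbij.1
    rw [← hcomm, ha, map_zero, map_zero]
  -- `x = x_ρ` descends to a point `y` of `𝕋`
  obtain ⟨y, hy⟩ : ∃ y : 𝕋 →+* PadicAlgCl p, y.comp φ = x :=
    ⟨RingHom.liftOfSurjective φ hφ ⟨x, hker⟩, RingHom.liftOfSurjective_comp φ hφ ⟨x, hker⟩⟩
  -- density + control at `y`, then Stub 4 (classicality in weight (2,2))
  refine stub_weightTwoClassicality p hp k red σ σ' hcpt ι S ρ hσ hσ' hirr hirr' hdet hnc hρirr hSh.1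
    hSh.2.1 hSh.2.2 fun n => ?_
  obtain ⟨y', r', hcls, hlev, htr, hclose⟩ := hdens y hy n
  refine ⟨r', hcls, hlev, fun g => ?_⟩
  have h1 : (ρ g).val.trace = y (φ (𝒯 g)) := by
    rw [← hx g, ← hy]
    rfl
  rw [h1, ← htr g]
  exact hclose _

end Summit.Langlands.Langlands.Cruxes.ResiduallyYoshidaLifting.EndoscopicCrossingEuler
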